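import Summits.QuantumFields.YangMills.Theses.BalabanUVNodes
import Summits.QuantumFields.YangMills.Theorems.BalabanUVNodesN27AtAllPinsOfRecord13CoPHVCutBFreeBareLedgerReadingKernelFaces
import Summits.QuantumFields.YangMills.Theorems.BalabanUVNodesN20OffLiveOneTermReading
import Summits.QuantumFields.YangMills.Theorems.BalabanUVNodesN22AtRecordOfTermDataTableGermsLocatedRadii
import Summits.QuantumFields.YangMills.Theorems.BalabanUVNodesN18KernelStepRateKingMechanismRecord
import Summits.QuantumFields.YangMills.Theorems.BalabanUVNodesN18AtRecordOfKernelLetters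

/-!
# ★★ LEAF AWBⱽ-1T-K-N22J76 (dag-n27-c g20) — n22-c g19's **ROAD-2 SOCKET OF RECORD** — — LEAF AWBⱽ-1T-K WITH THE N22 FACE ⟸ dag-n22-c's ROAD 2 AT def-W1's (2.14) TERM DATA, OLDER-TERM SIDE READ ENTIRELY FROM LOCATED RECORDS, AND S25's
# TERM-HOLOMORPHY-THROUGH-THE-CHART ROW DISCHARGED (module J76 `n22At_u3OfRecord₁₃_of_kernelStepRate_termDataTableGermsLocatedRadiiNonexpansive` = J68 §2 ∘ n10-c module 107 v1.1 §2 `…_tauRadii` ∘ dag-n18-c file 32 ∘ the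
# chart composition, τ-SIZE GONE): leaf G21 (J74) with N10's located record per term slice re-read WITHOUT the τ-size binder — `hι : … ∃ old₀ ∈ AdmHist, ∃ ι : Inputs226Holo c Z s ↑t old₀ φ a a₅,
# ∃ w₀, ((2.20) at old₀ with slack w₀ on Π ι.Uτ) ∧ (w₀ + (Σ_{Y ∈ 𝐃(s)} ((invTau c d(Y))⁻¹ + (𝔇 K k).r + 2))·((Σ_jΣ_X C_k)·m_k·(E₀ + b⁻¹R)) ≤ ι.w)`; every other row as in G21 (N18's located record `hloc18`,
# tables `big`, def-W1's laws + atom rows, holomorphic chart `hΦhol` + `U`-form space clause, numerics, sector holomorphy, standing rows).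
Cell `pub-ymgap`, HUMAN RULING D-0062 Track A; R134 seat `pub-ymgap-dag-n27-c` (N27 B5 composite, s2), gen 20, trigger (t2⁗); K3⁸ `SpineGivenEndpointR13SepCoPHV` = stmt-QuantumFields-27366
(skeleton v7 a85cbf6c34a09649 since 23:19Z 08-28, №238 re-cut of the stub-2 pin; v6 b4e55110ab73e679 retired; route decl unchanged), `--kind proof --supports 27366 --as helper`; COUNT-NEUTRAL.  ONE theorem, 0 `def`, 0 `sorry`; `N = 2`; guard `ZhUnity ∧ SlotsNondegenerate₁₃`; route-facing.
WHAT IS KERNEL-CHECKED ([bookkeeping]; plug C p650950's proof VERBATIM except the `h22'` line and the swapped rows): ★★★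
`spineGivenEndpointR13SepCoPHV_of_liveV5PinsAtCrOfRecord₁₃VAt_cut_bareLedgerReadingV_kernelFaces_n22TermDataTableGermsLocatedN18Adm_offLiveOneTerm_v5pins_bFree` ⊢ **`SpineGivenEndpointR13SepCoPHV` BY NAME**;
`h22' :=` J72 §2 per guarded admissible tuple (binders VERBATIM under `x ↦ x F θ`, `N ↦ 2`, `θ ↦ θ.toStage13Params`; renames for this file's namespace `g hκ₀ c L a b hL hb hK S D W E₀ Rd ↦ gh
hκh cB LB aB bw hL8 hbw hKb Sm Dz Wn EA Rt`, the records' bound `ι ↦ ιh`; instance binders as instance rows; `TDom tsys terms weight Lemma3Numerics Pot cv univ tdist1 K₀` qualified); `h18' ⟸ h5` as in C.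
HONEST FRAMING (binding): COMPOSITE-node bookkeeping BY NAME; a REDUCTION, not a discharge; every displayed row a HYPOTHESIS or a decided MODEL (0∕1 today; K0⁷ OPEN).  Per dag-n22-c ∕
dag-n18-c ∕ dag-n10-c ∕ node00-def-W1's own framing: the located records `hι` ∕ `hloc18`, def-W1's laws, `SpRestr`, the numerics and the [KP86] clause are DISPLAYED hypothesis SHAPES (GAPS
G-ne9p2-5, G-t4-U3-1∕-3), not printed inequalities; NE9 ∕ NE5 NOT IN PRINT for d = 4; `h5` is node N18's content (King's mechanism, NOT PRINTED for d = 4); sector holomorphy = the cell's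
reading of [I] p. 263 ∕ p. 266; `hlinkBareV` = NODE O's world (UNPRINTED, 0 instances); N11 NOT READ; `hβw` = K1's window currency (K1⁹ OPEN); nothing of Bałaban's or King's asserted or
instantiated; NOT `stub_rates13HV` ∕ `stub_expansion13HV`; N10 ∕ N14–N22 ∕ N27 NOT discharged (the chair books, R417); K3⁸ OPEN, NOT claimed; counts UNMOVED (typed 28∕28 · discharged
5∕27, A 5∕28); one finite four-torus programme at fixed `ε` — NOT ℝ⁴, NOT OS, NOT a mass gap, NOT Clay.  No decl below carries a cite tag.
-/

set_option autoImplicit false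

namespace Summit.QuantumFields.YangMills.Theorems.BalabanUVNodesN27SpineRecord
open scoped BigOperators Matrix Matrix.Norms.L2Operator
open Finset MeasureTheory
open Literature.MathematicalPhysics.QuantumFieldTheory.Balaban1983to89
open T4OutputRate T4RecentScale T4GoodClassBudget T4CauchySum T4TowerRateComposition T4TowerRateDischarge
open T4EtaRateMin (Readings NE3Shape)
open T4RateLiaison (GaugeDominated)
open FlowStep (RGEqH prefixOf)
open TreeLengthTorus (TFaceConnected torusTreeLen)
open B12TreeDecay (kappa₀)
open Summit.QuantumFields.BalabanUV.T4Continuum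
open AveragingDeficitDualResidual (dualC1 dualC2)
open AveragingDeficitDerivWallProof (wallConst)
open AveragingDeficitPeriodicCounting (IsPeriodicDir)
open MinimalActionSandwich (IsMinimiser minAct)
open MinimalActionRate (sfClass)
open MinimalActionRefine (RegularSup gradConst)
open NE3EnergyShapes (IsUnitarySite IsPeriodicSite)
open NE3.LeafIndexSockets (LeafH3sup)
open Summit.QuantumFields.BalabanUV.T4Continuum.Spine
open Summit.QuantumFields.BalabanUV.T4Continuum.Spine.NE4 (runFlow)
open Summit.QuantumFields.BalabanUV.T4Continuum.NE1p.DressedRoot (DressedTower DressedStabilityStrict)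
open Summit.QuantumFields.YangMills.BalabanUVNodes.N19LedgerLinkSync (LedgerDataSync LedgerAtSync)
open YMDAG.UVSplit
open Summit.QuantumFields.YangMills.BalabanUVNodes.N16HolderDefs (CovRootHolder N16HolderAt)
open Summit.QuantumFields.YangMills.BalabanUVNodes.SpineRatesHolder (RatesHolderAt)
open Literature.MathematicalPhysics.QuantumFieldTheory.Balaban1983to89.T4Continuum (T4Family ULoop)
open Node00 (Stage13HParams datumOfRecord₁₃CoPH SiteSeqKey U3Letters₁₁ NE3Letters₁₁ ne3ConstLayerOfRecord₁₁ ne3NperOfRecord₁₁ ne3DomOfRecord₁₁ ZetaMeasurable ppSelLiveOfRecord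
  EOfRecord₁₃ wOfRecord₉ localBgMeasurable)
open Literature.MathematicalPhysics.QuantumFieldTheory.Balaban1983to89.B12Sec2to5 (betaPrime510)
open Literature.MathematicalPhysics.QuantumFieldTheory.Balaban1983to89.Node00.U3OfKernels (objectsOfRecord₁₃ KernelDecayOfRecord₁₃)
open Literature.MathematicalPhysics.QuantumFieldTheory.Balaban1983to89.Node00.U3KernelLetters (GeometricIncrementsOfRecord₁₃ WindowedNE9OfRecord₁₃ WindowedDecayOfRecord₁₃
  WindowedStepRateOfRecord₁₃)
open Summit.QuantumFields.YangMills.BalabanUVNodes.N16PinnedLayer13CoPH (N16PinnedLoose N16LettersEnd rateCarriers_ne3_of_pinnedLoose)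
open Summit.QuantumFields.YangMills.BalabanUVNodes.N19TargetClassWeightsE1Keyed
open YMDAG.N14.TopBorn (Ne1PinnedOfRecord n14At_rateCarriersOfRecord₁₃CoPH_of_pinned)
open Summit.QuantumFields.YangMills.BalabanUVNodes.N15.GenuineRecord (fullGSizedObjects n15At_fullGSizedObjects_family)
open Summit.QuantumFields.YangMills.BalabanUVNodes.N15.AtKeyedHome (neZero_blockFactor)
open T4WeightBudget T4IndicatorShell T4ContinuumYM4Torus T4ApexHybrid
open Summit.QuantumFields.YangMills.Theses.BalabanUVNodes (SpineGivenEndpointR13SepCoPHV)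
open NE7 (Target)
open Summit.QuantumFields.YangMills.BalabanUVNodes.N20OffLiveOneTermReading (crOneTerm₁₃ h20_shape_crOneTerm₁₃ h21_shape_crOneTerm₁₃ extraction_crOneTerm₁₃ core_crOneTerm₁₃_iff_target)
open Literature.MathematicalPhysics.QuantumFieldTheory.Balaban1983to89.Node00 (MatA)
open Literature.MathematicalPhysics.QuantumFieldTheory.Balaban1983to89.Node00.LocalizedSum17 (ReadingMaps Localizes17OfRecord₁₃)
open Literature.MathematicalPhysics.QuantumFieldTheory.Balaban1983to89.Node00.Sect2 (domSys domCount CPair)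
open Literature.MathematicalPhysics.QuantumFieldTheory.Balaban1983to89.Node00.W1 (ClusterTower GenTower OlderTerms olderOf recTerm truncRun toClusterTower TermData214 TermLabel RecAdmissible AdmHist SpRestr)
open Literature.MathematicalPhysics.QuantumFieldTheory.Balaban1983to89.Node00.U3OfKernels (histPrefix)
open Literature.MathematicalPhysics.QuantumFieldTheory.Balaban1983to89.Node00.U3KernelLetters (KernelStepRateOfRecord₁₃ PolLimitsExistOfRecord₁₃)
open Literature.MathematicalPhysics.QuantumFieldTheory.Balaban1983to89.TreeLengthTorus (TPt)
open Literature.MathematicalPhysics.QuantumFieldTheory.Balaban1983to89.B12Decay510 (delta1)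
open Literature.MathematicalPhysics.QuantumFieldTheory.Balaban1983to89.B12Decay510Window (K₁)
open Literature.MathematicalPhysics.QuantumFieldTheory.Balaban1983to89.B12Decay510Torus (distCT nearT)
open YMDAG.N22.KernelFading (n22At_u3OfRecord₁₃_of_kernelStepRate_termDataTableGermsLocatedRadiiNonexpansive)
open YMDAG.N18.KernelStepRateKingMechanism (kernelStepRateOfRecord₁₃_mono)
open YMDAG.N18.AtRecordOfKernelLetters (n18At_u3OfRecord₁₃_objectsOfRecord₁₃_of_kernelStepRateOfRecord₁₃)
variable (K₀ : ℕ) (jc : (F : T4Family) → (θ : Stage13HParams F 2) → θ.Provisos₁₃CoPH F 2 → (ℕ → ℝ) → List (ULoop F) → ℕ → ℕ)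
  (sh : ShellSplit₁₃CoPH 2 K₀)
  (β : ℝ) (𝔯 : RateReading₁₃CoPH 2)
  (ℓ : (F : T4Family) → Stage13HParams F 2 → U3Letters₁₁)
  (ℓ₃ : T4Family → NE3Letters₁₁) (g B c' : T4Family → ℝ)
variable (𝔸 : (F : T4Family) → Stage13HParams F 2 → Type) [∀ (F : T4Family) (θ : Stage13HParams F 2), NormedRing (𝔸 F θ)]
  [∀ (F : T4Family) (θ : Stage13HParams F 2), NormedAlgebra ℂ (𝔸 F θ)] (Ec : (F : T4Family) → Stage13HParams F 2 → ℕ → ℕ → Type*)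
  [∀ (F : T4Family) (θ : Stage13HParams F 2) (K k : ℕ), NormedAddCommGroup (Ec F θ K k)] [∀ (F : T4Family) (θ : Stage13HParams F 2) (K k : ℕ), NormedSpace ℂ (Ec F θ K k)]
  (m' M : (F : T4Family) → Stage13HParams F 2 → ℕ) [hM0 : ∀ (F : T4Family) (θ : Stage13HParams F 2), NeZero (M F θ)]
  (c₀ : (F : T4Family) → Stage13HParams F 2 → B13.Consts) (LB : (F : T4Family) → Stage13HParams F 2 → ℕ) [hL0 : ∀ (F : T4Family) (θ : Stage13HParams F 2), NeZero (LB F θ)]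
  (𝔇 : (F : T4Family) → (θ : Stage13HParams F 2) → (K : ℕ) → TermData214 (c₀ F θ) (F.P K) (𝔸 F θ) (M F θ) (LB F θ))
  (emb : (F : T4Family) → (θ : Stage13HParams F 2) → ReadingMaps F (MatA 2) (𝔸 F θ))
  (sp : (F : T4Family) → (θ : Stage13HParams F 2) → (K j : ℕ) → (domSys (F.P K) (M F θ) j).Dom → Set (CPair (F.P K) (𝔸 F θ)))
  (κ₅ C₅ κ κE δ₀ B₃ r R EA ϱ Mb cw cS Bq r₁ Ck mk aB a₂ a₂' a₅ Aabs bw : (F : T4Family) → Stage13HParams F 2 → ℝ)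
  (aw : (F : T4Family) → Stage13HParams F 2 → ℕ → ℕ → ℕ → ℝ)
  (big : (F : T4Family) → (θ : Stage13HParams F 2) → (K j : ℕ) → (domSys (F.P K) (M F θ) j).Dom → Set (CPair (F.P K) (𝔸 F θ)))
  (Dz : (F : T4Family) → (θ : Stage13HParams F 2) → ℕ → Set ℂ)
  (Sm : (F : T4Family) → (θ : Stage13HParams F 2) → ℕ → ℕ → Type) [∀ (F : T4Family) (θ : Stage13HParams F 2) (K k : ℕ), MeasurableSpace (Sm F θ K k)]
  [∀ (F : T4Family) (θ : Stage13HParams F 2) (K k : ℕ), TopologicalSpace (Sm F θ K k)] [∀ (F : T4Family) (θ : Stage13HParams F 2) (K k : ℕ), OpensMeasurableSpace (Sm F θ K k)]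
  (χu : (F : T4Family) → (θ : Stage13HParams F 2) → (K k : ℕ) → (𝔇 F θ K k).UnscaledChi)
  (χcu : (F : T4Family) → (θ : Stage13HParams F 2) → (K k : ℕ) → (𝔇 F θ K k).UnscaledChi)
  (𝒲 : (F : T4Family) → (θ : Stage13HParams F 2) → (K k : ℕ) → (𝔇 F θ K k).UnscaledWilson)
  (𝒪 : (F : T4Family) → (θ : Stage13HParams F 2) → (K k : ℕ) → (𝔇 F θ K k).UnscaledOlder)
  (Rt : (F : T4Family) → (θ : Stage13HParams F 2) → (K k : ℕ) → (Z : (domSys (F.P K) (M F θ) (k + 1)).Dom) → (t : TermLabel (F.P K) (M F θ) k (LB F θ)) → (𝔇 F θ K k).ReadingAtoms Z t (Sm F θ K k))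
  (Wn : (F : T4Family) → (θ : Stage13HParams F 2) → (K k : ℕ) → (domSys (F.P K) (M F θ) (k + 1)).Dom → TermLabel (F.P K) (M F θ) k (LB F θ) → Set (CPair (F.P K) (𝔸 F θ)))
  (cB : (F : T4Family) → (θ : Stage13HParams F 2) → B13.Consts)
  (O : (F : T4Family) → (θ : Stage13HParams F 2) → ℕ → Set ℂ)
  (V : (F : T4Family) → (θ : Stage13HParams F 2) → (K k : ℕ) → OlderTerms (F.P K) (𝔸 F θ) (M F θ) k → CPair (F.P K) (𝔸 F θ) → (domSys (F.P K) (M F θ) (k + 1)).Dom → ℂ)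
  (ι : (F : T4Family) → (θ : Stage13HParams F 2) →
      (letI := θ.instVβ₁; letI := θ.instVβ₂;
      (K k : ℕ) → (domSys (F.P K) (M F θ) (k + 1)).Dom → ((Fin (F.P K).d → Site (F.P K) (k + 1) → θ.Vβ) →L[ℝ] Ec F θ K k)))
  (Φ : (F : T4Family) → (θ : Stage13HParams F 2) → (K k : ℕ) → (domSys (F.P K) (M F θ) (k + 1)).Dom → Ec F θ K k → CPair (F.P K) (𝔸 F θ))
  (U : (F : T4Family) → (θ : Stage13HParams F 2) → (K k : ℕ) → (domSys (F.P K) (M F θ) (k + 1)).Dom → Set (Ec F θ K k))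
  (w : (F : T4Family) → (θ : Stage13HParams F 2) → (K k : ℕ) → (domSys (F.P K) (M F θ) (k + 1)).Dom → Site (F.P K) (k + 1) → ℝ)

open Classical in
/-- ★★★ **THE ITEM `SpineGivenEndpointR13SepCoPHV` AT EVERY VERSION SLOT — LIVE: ALL PINS, NODE U3 AT THE LIMITING KERNELS OF RECORD WITH THE N22 FACE ⟸ dag-n22-c's ROAD 2 AT
def-W1's TERM DATA, OLDER-TERM SIDE FROM LOCATED RECORDS, SOCKET OF RECORD (J76, τ-size gone: N18's rate letter `h5` + N10's located record `hι` + N18's located record `hloc18` + tables `big` +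
def-W1's laws + numerics + sector holomorphy + chart DATA with a holomorphic chart `hΦhol` + the STANDING rows; NO analytic row on the towers) AND THE N18 FACE ⟸ `h5`, N19′ AT THE BARE LEDGER READING; OFF-LIVE: ONE (B)-FREE TARGET ROW** (plug C's proof with `h22' :=`
J76 §2).  NOT a discharge; every row a HYPOTHESIS or a decided MODEL; NE9 ∕ NE5 NOT IN PRINT for d = 4; nothing asserted for any family; no node discharged; K3⁸ OPEN. [bookkeeping] -/
theorem spineGivenEndpointR13SepCoPHV_of_liveV5PinsAtCrOfRecord₁₃VAt_cut_bareLedgerReadingV_kernelFaces_n22TermDataTableGermsLocatedRadii_offLiveOneTerm_v5pins_bFree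
    (ksel : (F : T4Family) → (θ : Stage13HParams F 2) → θ.Provisos₁₃CoPH F 2 → (ℕ → ℝ) → List (ULoop F) → ℕ)
    (hpin1 : Ne1PinnedOfRecord 𝔯)
    (hpin2 : ∃ (b aS : ℝ) (ν μ α β' : Fin 4) (c35 p : ℝ), 0 < b ∧ 0 < aS ∧
      ∀ (F : T4Family) (θ : Stage13HParams F 2) (hP : θ.Provisos₁₃CoPH F 2) (g₀ : ℕ → ℝ) (os : List (ULoop F)) (k : ℕ),
        (𝔯.lit F θ hP g₀ os).ne2 k = haveI := neZero_blockFactor F; fullGSizedObjects 3 F.hL b aS ν μ α β' c35 p)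
    (hpinL : N16PinnedLoose 𝔯 ℓ₃ B)
    (hpin : ∀ (F : T4Family) (θ : Stage13HParams F 2) (hP : θ.Provisos₁₃CoPH F 2) (g₀ : ℕ → ℝ) (os : List (ULoop F)),
      (𝔯.lit F θ hP g₀ os).u3 = objectsOfRecord₁₃ F 2 θ.toStage13Params (ℓ F θ))
    (h16 : ∀ (F : T4Family), (∃ θ : Stage13HParams F 2, θ.Provisos₁₃CoPH F 2 ∧ (θ.ZhUnity F 2 ∧ θ.SlotsNondegenerate₁₃ F 2) ∧ θ.Admissible F 2) →
      N16HolderAt (ne3OfRecord₁₁ F { ne3ConstLayerOfRecord₁₁ F 2 (ℓ₃ F) with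
        dom := {V | V ∈ ne3DomOfRecord₁₁ F 2 0 0 ∧ V ∈ sfClass 4 F.L (ne3NperOfRecord₁₁ F 0 0) ((ℓ₃ F).ε / B F) 0} }) β)
    (hs : ∀ (F : T4Family) (θ : Stage13HParams F 2), θ.Provisos₁₃CoPH F 2 → (θ.ZhUnity F 2 ∧ θ.SlotsNondegenerate₁₃ F 2) → θ.Admissible F 2 → (ℓ F θ).Signs)
    (hκ : ∀ (F : T4Family) (θ : Stage13HParams F 2), θ.Provisos₁₃CoPH F 2 → (θ.ZhUnity F 2 ∧ θ.SlotsNondegenerate₁₃ F 2) → θ.Admissible F 2 → 0 < (ℓ F θ).κ)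
    (hcr : ∀ (F : T4Family) (θ : Stage13HParams F 2), θ.Provisos₁₃CoPH F 2 → (θ.ZhUnity F 2 ∧ θ.SlotsNondegenerate₁₃ F 2) → θ.Admissible F 2 →
      betaPrime510 4 1 (ℓ F θ).κ ≤ (ℓ F θ).cr)
    (hκ₀ : ∀ (F : T4Family) (θ : Stage13HParams F 2), θ.Provisos₁₃CoPH F 2 → (θ.ZhUnity F 2 ∧ θ.SlotsNondegenerate₁₃ F 2) → θ.Admissible F 2 → kappa₀ (4 * 2 ^ 4) (2 * 4) ≤ (ℓ F θ).κ)
    (hK : ∀ (μ ν : Fin 4) (F : T4Family) (θ : Stage13HParams F 2), θ.Provisos₁₃CoPH F 2 → (θ.ZhUnity F 2 ∧ θ.SlotsNondegenerate₁₃ F 2) → θ.Admissible F 2 →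
      KernelDecayOfRecord₁₃ F 2 θ.toStage13Params μ ν (ℓ F θ).κ)
    -- node N18's LIMIT letter at the rate `κ₅` with constant `C₅` (J49's `h5`), keyed to `ℓ F θ` by domination (`hC₅ℓ`, `hℓκ`∕`hκ₅`); (1.21)
    (hlim : ∀ (F : T4Family) (θ : Stage13HParams F 2), θ.Provisos₁₃CoPH F 2 → (θ.ZhUnity F 2 ∧ θ.SlotsNondegenerate₁₃ F 2) → θ.Admissible F 2 → PolLimitsExistOfRecord₁₃ F 2 θ.toStage13Params)
    (h5 : ∀ (F : T4Family) (θ : Stage13HParams F 2), θ.Provisos₁₃CoPH F 2 → (θ.ZhUnity F 2 ∧ θ.SlotsNondegenerate₁₃ F 2) → θ.Admissible F 2 →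
      KernelStepRateOfRecord₁₃ F 2 θ.toStage13Params (κ₅ F θ) (ℓ F θ).θ₅ (C₅ F θ))
    (hC₅ : ∀ (F : T4Family) (θ : Stage13HParams F 2), θ.Provisos₁₃CoPH F 2 → (θ.ZhUnity F 2 ∧ θ.SlotsNondegenerate₁₃ F 2) → θ.Admissible F 2 → 0 ≤ C₅ F θ) (hC₅ℓ : ∀ (F : T4Family) (θ : Stage13HParams F 2), θ.Provisos₁₃CoPH F 2 → (θ.ZhUnity F 2 ∧ θ.SlotsNondegenerate₁₃ F 2) → θ.Admissible F 2 → C₅ F θ ≤ (ℓ F θ).C₅)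
    -- dag-n22-c J76 §2's binders (`…N22AtRecordOfTermDataTableGermsLocatedRadii` = n22-c g19's ROAD-2 SOCKET OF RECORD) under `x ↦ x F θ`: leaf G21's rows with the τ-size gone from N10's located
    -- record — `hι : … ∃ old₀ ∈ AdmHist, ∃ ιh : Inputs226Holo …, ∃ w₀, ((2.20) at old₀ with slack w₀) ∧ (w₀ + (Σ_{Y ∈ 𝐃(s)} ((invTau cB d(Y))⁻¹ + (𝔇 K k).r + 2))·((Σ_jΣ_X Ck)·mk·(EA + bw⁻¹R)) ≤ ιh.w)`
    -- (n10-c module 107 v1.1 §2 `…_tauRadii` inside J76); every other row as in G21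
    (hM : ∀ (F : T4Family) (θ : Stage13HParams F 2), θ.Provisos₁₃CoPH F 2 → (θ.ZhUnity F 2 ∧ θ.SlotsNondegenerate₁₃ F 2) → θ.Admissible F 2 → M F θ = F.L ^ m' F θ)
    (hloc : ∀ (F : T4Family) (θ : Stage13HParams F 2), θ.Provisos₁₃CoPH F 2 → (θ.ZhUnity F 2 ∧ θ.SlotsNondegenerate₁₃ F 2) → θ.Admissible F 2 → Localizes17OfRecord₁₃ F 2 θ.toStage13Params (fun K => truncRun K (toClusterTower (𝔇 F θ K).Gn)) (emb F θ))
    (hsp : ∀ (F : T4Family) (θ : Stage13HParams F 2), θ.Provisos₁₃CoPH F 2 → (θ.ZhUnity F 2 ∧ θ.SlotsNondegenerate₁₃ F 2) → θ.Admissible F 2 → ∀ (K j : ℕ) (Y : (domSys (F.P K) (M F θ) j).Dom), IsOpen (sp F θ K j Y))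
    (hκh : ∀ (F : T4Family) (θ : Stage13HParams F 2), θ.Provisos₁₃CoPH F 2 → (θ.ZhUnity F 2 ∧ θ.SlotsNondegenerate₁₃ F 2) → θ.Admissible F 2 → kappa₀ (4 * 2 ^ 4) (2 * 4) ≤ κ F θ / 2)
    (hδ₀ : ∀ (F : T4Family) (θ : Stage13HParams F 2), θ.Provisos₁₃CoPH F 2 → (θ.ZhUnity F 2 ∧ θ.SlotsNondegenerate₁₃ F 2) → θ.Admissible F 2 → 0 < δ₀ F θ)
    (hB₃ : ∀ (F : T4Family) (θ : Stage13HParams F 2), θ.Provisos₁₃CoPH F 2 → (θ.ZhUnity F 2 ∧ θ.SlotsNondegenerate₁₃ F 2) → θ.Admissible F 2 → 0 ≤ B₃ F θ)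
    (hr : ∀ (F : T4Family) (θ : Stage13HParams F 2), θ.Provisos₁₃CoPH F 2 → (θ.ZhUnity F 2 ∧ θ.SlotsNondegenerate₁₃ F 2) → θ.Admissible F 2 → 0 < r F θ)
    (hκE : ∀ (F : T4Family) (θ : Stage13HParams F 2), θ.Provisos₁₃CoPH F 2 → (θ.ZhUnity F 2 ∧ θ.SlotsNondegenerate₁₃ F 2) → θ.Admissible F 2 → κ F θ ≤ κE F θ)
    (hκE0 : ∀ (F : T4Family) (θ : Stage13HParams F 2), θ.Provisos₁₃CoPH F 2 → (θ.ZhUnity F 2 ∧ θ.SlotsNondegenerate₁₃ F 2) → θ.Admissible F 2 → 0 ≤ κE F θ)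
    (hE₀ : ∀ (F : T4Family) (θ : Stage13HParams F 2), θ.Provisos₁₃CoPH F 2 → (θ.ZhUnity F 2 ∧ θ.SlotsNondegenerate₁₃ F 2) → θ.Admissible F 2 → 0 ≤ EA F θ)
    (hbigo : ∀ (F : T4Family) (θ : Stage13HParams F 2), θ.Provisos₁₃CoPH F 2 → (θ.ZhUnity F 2 ∧ θ.SlotsNondegenerate₁₃ F 2) → θ.Admissible F 2 → ∀ (K k : ℕ) (Z : (domSys (F.P K) (M F θ) (k + 1)).Dom), IsOpen (big F θ K (k + 1) Z))
    (hrestr : ∀ (F : T4Family) (θ : Stage13HParams F 2), θ.Provisos₁₃CoPH F 2 → (θ.ZhUnity F 2 ∧ θ.SlotsNondegenerate₁₃ F 2) → θ.Admissible F 2 → ∀ (K k : ℕ), SpRestr (sp F θ K (k + 1)))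
    (hbig : ∀ (F : T4Family) (θ : Stage13HParams F 2), θ.Provisos₁₃CoPH F 2 → (θ.ZhUnity F 2 ∧ θ.SlotsNondegenerate₁₃ F 2) → θ.Admissible F 2 → ∀ (K k : ℕ) (Z : (domSys (F.P K) (M F θ) (k + 1)).Dom), sp F θ K (k + 1) Z ⊆ big F θ K (k + 1) Z)
    (hL8 : ∀ (F : T4Family) (θ : Stage13HParams F 2), θ.Provisos₁₃CoPH F 2 → (θ.ZhUnity F 2 ∧ θ.SlotsNondegenerate₁₃ F 2) → θ.Admissible F 2 → 8 ≤ (cB F θ).L)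
    (hLc : ∀ (F : T4Family) (θ : Stage13HParams F 2), θ.Provisos₁₃CoPH F 2 → (θ.ZhUnity F 2 ∧ θ.SlotsNondegenerate₁₃ F 2) → θ.Admissible F 2 → (cB F θ).L = LB F θ)
    (hκ₁ : ∀ (F : T4Family) (θ : Stage13HParams F 2), θ.Provisos₁₃CoPH F 2 → (θ.ZhUnity F 2 ∧ θ.SlotsNondegenerate₁₃ F 2) → θ.Admissible F 2 → 1 ≤ (cB F θ).κ₁)
    (hα₆ : ∀ (F : T4Family) (θ : Stage13HParams F 2), θ.Provisos₁₃CoPH F 2 → (θ.ZhUnity F 2 ∧ θ.SlotsNondegenerate₁₃ F 2) → θ.Admissible F 2 → (cB F θ).α₆ ≠ 0)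
    (hN : ∀ (F : T4Family) (θ : Stage13HParams F 2), θ.Provisos₁₃CoPH F 2 → (θ.ZhUnity F 2 ∧ θ.SlotsNondegenerate₁₃ F 2) → θ.Admissible F 2 → B13Lemma3TorusSocket.Lemma3Numerics (cB F θ) (M F θ) (((cB F θ).L : ℝ) / 2) (aB F θ) (a₂ F θ) (a₂' F θ) (a₅ F θ) (Aabs F θ))
    (hloc18 : ∀ (F : T4Family) (θ : Stage13HParams F 2), θ.Provisos₁₃CoPH F 2 → (θ.ZhUnity F 2 ∧ θ.SlotsNondegenerate₁₃ F 2) → θ.Admissible F 2 → ∀ (K k : ℕ), ∀ s ∈ Dz F θ K, ∀ old : OlderTerms (F.P K) (𝔸 F θ) (M F θ) k,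
      (∀ (j : Fin (k + 1)) (Y : (domSys (F.P K) (M F θ) j).Dom), ∀ ψ ∈ sp F θ K j Y, ‖old j Y ψ‖ ≤ EA F θ * Real.exp (-(r₁ F θ * (domSys (F.P K) (M F θ) j).dj Y))) →
      (∀ (j : Fin (k + 1)) (Y : (domSys (F.P K) (M F θ) j).Dom), AnalyticOnNhd ℂ (old j Y) (sp F θ K j Y)) →
      ∀ (Z : (domSys (F.P K) (M F θ) (k + 1)).Dom), ∀ t ∈ B13Lemma3TorusTerms.terms (LB F θ) (M F θ) Z, ∀ φ₁ ∈ big F θ K (k + 1) Z, ∃ ιh : (𝔇 F θ K k).Inputs226Holo (cB F θ) Z t s old φ₁ (aB F θ) (a₅ F θ),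
        (∀ φ ∈ big F θ K (k + 1) Z, ∀ i j, DifferentiableOn ℂ (fun σ => (𝔇 F θ K k).A Z t φ σ i j) {σ | ∀ j, σ j ∈ ιh.Uσ}) ∧
        (∀ φ ∈ big F θ K (k + 1) Z, ∀ i j, DifferentiableOn ℂ (fun σ => ((𝔇 F θ K k).𝒦 Z t).G2 σ ((𝔇 F θ K k).uOf Z t φ) i j) {σ | ∀ j, σ j ∈ ιh.Uσ}) ∧
        (∀ σ : TPt (F.P K).d (domCount (F.P K) (M F θ) (k + 1)) → ℂ, (∀ j, σ j ∈ ιh.Uσ) → ∀ i j, DifferentiableOn ℂ (fun φ => (𝔇 F θ K k).A Z t φ σ i j) (big F θ K (k + 1) Z)) ∧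
        (∀ σ : TPt (F.P K).d (domCount (F.P K) (M F θ) (k + 1)) → ℂ, (∀ j, σ j ∈ ιh.Uσ) →
          ∀ i j, DifferentiableOn ℂ (fun φ => ((𝔇 F θ K k).𝒦 Z t).G2 σ ((𝔇 F θ K k).uOf Z t φ) i j) (big F θ K (k + 1) Z)) ∧
        (∀ Y B, DifferentiableOn ℂ (fun φ => (𝔇 F θ K k).𝒱 Z t s old φ Y B) (big F θ K (k + 1) Z)) ∧
        (∀ φ ∈ big F θ K (k + 1) Z, ∀ Y, Measurable ((𝔇 F θ K k).𝒱 Z t s old φ Y)) ∧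
        (∀ φ ∈ big F θ K (k + 1) Z, ∀ σ : TPt (F.P K).d (domCount (F.P K) (M F θ) (k + 1)) → ℂ, (∀ j, σ j ∈ ιh.Uσ) → ((𝔇 F θ K k).A Z t φ σ).IsSymm) ∧
        (∀ φ ∈ big F θ K (k + 1) Z, ∀ σ : TPt (F.P K).d (domCount (F.P K) (M F θ) (k + 1)) → ℂ, (∀ j, σ j ∈ ιh.Uσ) → (((𝔇 F θ K k).A Z t φ σ).map Complex.re).PosDef) ∧
        (∀ φ ∈ big F θ K (k + 1) Z, ∀ τ : TreeLengthTorus.TDom (F.P K).d (LB F θ * domCount (F.P K) (M F θ) (k + 1)) → ℂ, (∀ Y, τ Y ∈ ιh.Uτ Y) →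
          ∀ B, ∑ Y ∈ t.1, ‖τ Y‖ * ‖(𝔇 F θ K k).𝒱 Z t s old φ Y B‖ ≤ ιh.a₂₀ / 2 * (B ⬝ᵥ B) + ιh.w) ∧
        (∀ φ ∈ big F θ K (k + 1) Z, ∀ σ : TPt (F.P K).d (domCount (F.P K) (M F θ) (k + 1)) → ℂ, (∀ j, σ j ∈ ιh.Uσ) → ∀ b j, ‖((𝔇 F θ K k).𝒦 Z t).G2 σ ((𝔇 F θ K k).uOf Z t φ) b j‖ ≤
            ιh.KG * Real.exp (-(ιh.kap * B9Thm37GlueTorus.tdist1 (𝔇 F θ K k).Nf (((𝔇 F θ K k).𝒦 Z t).locΛ b) (((𝔇 F θ K k).𝒦 Z t).locN j)))) ∧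
        (∀ φ ∈ big F θ K (k + 1) Z, ∀ σ : TPt (F.P K).d (domCount (F.P K) (M F θ) (k + 1)) → ℂ, (∀ j, σ j ∈ ιh.Uσ) → ∀ b b', ‖((𝔇 F θ K k).A Z t φ σ)⁻¹ b b'‖ ≤
            ιh.KCs * Real.exp (-(ιh.kap * B9Thm37GlueTorus.tdist1 (𝔇 F θ K k).Nf (((𝔇 F θ K k).𝒦 Z t).locΛ b) (((𝔇 F θ K k).𝒦 Z t).locΛ b')))) ∧
        (∀ φ ∈ big F θ K (k + 1) Z, ∀ σ : TPt (F.P K).d (domCount (F.P K) (M F θ) (k + 1)) → ℂ, (∀ j, σ j ∈ ιh.Uσ) →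
          ∀ b j, ‖(((𝔇 F θ K k).𝒦 Z t).G2 σ ((𝔇 F θ K k).uOf Z t φ) - ((𝔇 F θ K k).𝒦 Z t).Γ₀.map (algebraMap ℝ ℂ)) b j‖ ≤
            ιh.θΓ * Real.exp (-(ιh.kap * B9Thm37GlueTorus.tdist1 (𝔇 F θ K k).Nf (((𝔇 F θ K k).𝒦 Z t).locΛ b) (((𝔇 F θ K k).𝒦 Z t).locN j)))) ∧
        (∀ φ ∈ big F θ K (k + 1) Z, ∀ σ : TPt (F.P K).d (domCount (F.P K) (M F θ) (k + 1)) → ℂ, (∀ j, σ j ∈ ιh.Uσ) →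
          ∀ b b', ‖(((𝔇 F θ K k).A Z t φ σ)⁻¹ - ((𝔇 F θ K k).𝒦 Z t).C.map (algebraMap ℝ ℂ)) b b'‖ ≤
            ιh.θC * Real.exp (-(ιh.kap * B9Thm37GlueTorus.tdist1 (𝔇 F θ K k).Nf (((𝔇 F θ K k).𝒦 Z t).locΛ b) (((𝔇 F θ K k).𝒦 Z t).locΛ b')))) ∧
        (∀ φ ∈ big F θ K (k + 1) Z, ∀ σ : TPt (F.P K).d (domCount (F.P K) (M F θ) (k + 1)) → ℂ, (∀ j, σ j ∈ ιh.Uσ) →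
          ∀ b b', ‖((𝔇 F θ K k).A Z t φ σ - ((𝔇 F θ K k).𝒦 Z t).C⁻¹.map (algebraMap ℝ ℂ)) b b'‖ ≤
            ιh.θE * Real.exp (-(ιh.kap * B9Thm37GlueTorus.tdist1 (𝔇 F θ K k).Nf (((𝔇 F θ K k).𝒦 Z t).locΛ b) (((𝔇 F θ K k).𝒦 Z t).locΛ b')))))
    (hD : ∀ (F : T4Family) (θ : Stage13HParams F 2), θ.Provisos₁₃CoPH F 2 → (θ.ZhUnity F 2 ∧ θ.SlotsNondegenerate₁₃ F 2) → θ.Admissible F 2 → ∀ K, ∀ t ∈ Set.Ioc (0 : ℝ) θ.γ, ((t : ℝ) : ℂ) ∈ Dz F θ K)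
    (hlaw : ∀ (F : T4Family) (θ : Stage13HParams F 2), θ.Provisos₁₃CoPH F 2 → (θ.ZhUnity F 2 ∧ θ.SlotsNondegenerate₁₃ F 2) → θ.Admissible F 2 → ∀ K, (𝔇 F θ K).UnscaledFieldLawOn (χu F θ K) (χcu F θ K) (𝒲 F θ K) (𝒪 F θ K) θ.γ)
    (hread : ∀ (F : T4Family) (θ : Stage13HParams F 2), θ.Provisos₁₃CoPH F 2 → (θ.ZhUnity F 2 ∧ θ.SlotsNondegenerate₁₃ F 2) → θ.Admissible F 2 → ∀ K k, (𝔇 F θ K k).ReadsBy (𝒪 F θ K k) (Rt F θ K k))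
    (hmaps : ∀ (F : T4Family) (θ : Stage13HParams F 2), θ.Provisos₁₃CoPH F 2 → (θ.ZhUnity F 2 ∧ θ.SlotsNondegenerate₁₃ F 2) → θ.Admissible F 2 → ∀ (K k : ℕ) (Z : (domSys (F.P K) (M F θ) (k + 1)).Dom) (t : TermLabel (F.P K) (M F θ) k (LB F θ)), (Rt F θ K k Z t).MapsToTables (sp F θ K) (Wn F θ K k Z t) Set.univ)
    (hW : ∀ (F : T4Family) (θ : Stage13HParams F 2), θ.Provisos₁₃CoPH F 2 → (θ.ZhUnity F 2 ∧ θ.SlotsNondegenerate₁₃ F 2) → θ.Admissible F 2 → ∀ (K k : ℕ) (X Z : (domSys (F.P K) (M F θ) (k + 1)).Dom), Subtype.val Z ⊆ Subtype.val X → ∀ s ∈ B13Lemma3TorusTerms.terms (LB F θ) (M F θ) Z, sp F θ K (k + 1) X ⊆ Wn F θ K k Z s)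
    (hcont : ∀ (F : T4Family) (θ : Stage13HParams F 2), θ.Provisos₁₃CoPH F 2 → (θ.ZhUnity F 2 ∧ θ.SlotsNondegenerate₁₃ F 2) → θ.Admissible F 2 → ∀ (K k : ℕ) (Z : (domSys (F.P K) (M F θ) (k + 1)).Dom) (t : TermLabel (F.P K) (M F θ) k (LB F θ)), (Rt F θ K k Z t).CfgContinuous)
    (hjc : ∀ (F : T4Family) (θ : Stage13HParams F 2), θ.Provisos₁₃CoPH F 2 → (θ.ZhUnity F 2 ∧ θ.SlotsNondegenerate₁₃ F 2) → θ.Admissible F 2 → ∀ (K k : ℕ) (Z : (domSys (F.P K) (M F θ) (k + 1)).Dom) (t : TermLabel (F.P K) (M F θ) k (LB F θ)), (Rt F θ K k Z t).CfgJointContinuous)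
    (hKb : ∀ (F : T4Family) (θ : Stage13HParams F 2), θ.Provisos₁₃CoPH F 2 → (θ.ZhUnity F 2 ∧ θ.SlotsNondegenerate₁₃ F 2) → θ.Admissible F 2 → ∀ (K k : ℕ) (Z : (domSys (F.P K) (M F θ) (k + 1)).Dom) (t : TermLabel (F.P K) (M F θ) k (LB F θ)), (Rt F θ K k Z t).KernelBounded (Ck F θ))
    (hμ : ∀ (F : T4Family) (θ : Stage13HParams F 2), θ.Provisos₁₃CoPH F 2 → (θ.ZhUnity F 2 ∧ θ.SlotsNondegenerate₁₃ F 2) → θ.Admissible F 2 → ∀ (K k : ℕ) (Z : (domSys (F.P K) (M F θ) (k + 1)).Dom) (t : TermLabel (F.P K) (M F θ) k (LB F θ)), (Rt F θ K k Z t).FiniteMass (mk F θ))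
    (hCk : ∀ (F : T4Family) (θ : Stage13HParams F 2), θ.Provisos₁₃CoPH F 2 → (θ.ZhUnity F 2 ∧ θ.SlotsNondegenerate₁₃ F 2) → θ.Admissible F 2 → 0 ≤ Ck F θ)
    (hmk : ∀ (F : T4Family) (θ : Stage13HParams F 2), θ.Provisos₁₃CoPH F 2 → (θ.ZhUnity F 2 ∧ θ.SlotsNondegenerate₁₃ F 2) → θ.Admissible F 2 → 0 ≤ mk F θ)
    (hWm : ∀ (F : T4Family) (θ : Stage13HParams F 2), θ.Provisos₁₃CoPH F 2 → (θ.ZhUnity F 2 ∧ θ.SlotsNondegenerate₁₃ F 2) → θ.Admissible F 2 →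
      ∀ (K k : ℕ) (Z : (domSys (F.P K) (M F θ) (k + 1)).Dom) (t : TermLabel (F.P K) (M F θ) k (LB F θ)) (φ : CPair (F.P K) (𝔸 F θ)) (Y : TreeLengthTorus.TDom (F.P K).d (LB F θ * domCount (F.P K) (M F θ) (k + 1))),
      Measurable fun B : ((𝔇 F θ K k).𝒦 Z t).Λ → ℝ => 𝒲 F θ K k Z t φ Y B)
    (hbw : ∀ (F : T4Family) (θ : Stage13HParams F 2), θ.Provisos₁₃CoPH F 2 → (θ.ZhUnity F 2 ∧ θ.SlotsNondegenerate₁₃ F 2) → θ.Admissible F 2 → 0 < bw F θ)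
    (hbaw : ∀ (F : T4Family) (θ : Stage13HParams F 2), θ.Provisos₁₃CoPH F 2 → (θ.ZhUnity F 2 ∧ θ.SlotsNondegenerate₁₃ F 2) → θ.Admissible F 2 → ∀ K k j, bw F θ ≤ aw F θ K k j)
    (hι : ∀ (F : T4Family) (θ : Stage13HParams F 2), θ.Provisos₁₃CoPH F 2 → (θ.ZhUnity F 2 ∧ θ.SlotsNondegenerate₁₃ F 2) → θ.Admissible F 2 → ∀ (K k : ℕ), ∀ t ∈ Set.Ioc (0 : ℝ) θ.γ, ∀ (X : (domSys (F.P K) (M F θ) (k + 1)).Dom), ∀ φ ∈ sp F θ K (k + 1) X,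
      ∀ Z : (domSys (F.P K) (M F θ) (k + 1)).Dom, Subtype.val Z ⊆ Subtype.val X → ∀ s ∈ B13Lemma3TorusTerms.terms (LB F θ) (M F θ) Z,
        ∃ old₀ ∈ AdmHist (sp F θ K) (EA F θ) (r₁ F θ) k, ∃ ιh : (𝔇 F θ K k).Inputs226Holo (cB F θ) Z s ((t : ℝ) : ℂ) old₀ φ (aB F θ) (a₅ F θ), ∃ w₀ : ℝ,
          (∀ τ : TreeLengthTorus.TDom (F.P K).d (LB F θ * domCount (F.P K) (M F θ) (k + 1)) → ℂ, (∀ Y, τ Y ∈ ιh.Uτ Y) → ∀ B : ((𝔇 F θ K k).𝒦 Z s).Λ → ℝ,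
            ∑ Y ∈ s.1, ‖τ Y‖ * ‖(𝔇 F θ K k).𝒱 Z s ((t : ℝ) : ℂ) old₀ φ Y B‖ ≤ ιh.a₂₀ / 2 * (B ⬝ᵥ B) + w₀) ∧
          w₀ + (∑ Y ∈ s.1, ((B13Bound143.invTau (cB F θ) ((TreeLengthTorus.tsys (F.P K).d (LB F θ * domCount (F.P K) (M F θ) (k + 1))).dj Y))⁻¹ + (𝔇 F θ K k).r + 2)) *
            ((∑ _j : Fin (k + 1), ∑ _X : (domSys (F.P K) (M F θ) _j).Dom, Ck F θ) * mk F θ * (EA F θ + (bw F θ)⁻¹ * R F θ)) ≤ ιh.w)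
    (hA0 : ∀ (F : T4Family) (θ : Stage13HParams F 2), θ.Provisos₁₃CoPH F 2 → (θ.ZhUnity F 2 ∧ θ.SlotsNondegenerate₁₃ F 2) → θ.Admissible F 2 → 0 ≤ (cB F θ).C3act * (cB F θ).ε₁)
    (hr₁ : ∀ (F : T4Family) (θ : Stage13HParams F 2), θ.Provisos₁₃CoPH F 2 → (θ.ZhUnity F 2 ∧ θ.SlotsNondegenerate₁₃ F 2) → θ.Admissible F 2 → 0 ≤ r₁ F θ)
    (hrate : ∀ (F : T4Family) (θ : Stage13HParams F 2), θ.Provisos₁₃CoPH F 2 → (θ.ZhUnity F 2 ∧ θ.SlotsNondegenerate₁₃ F 2) → θ.Admissible F 2 → r₁ F θ + 2 * (64 * Real.log 162) + 2 ≤ (1 - 8 * (cB F θ).δ) * (((cB F θ).L : ℝ) / 2) * (cB F θ).κ)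
    (hKP : ∀ (F : T4Family) (θ : Stage13HParams F 2), θ.Provisos₁₃CoPH F 2 → (θ.ZhUnity F 2 ∧ θ.SlotsNondegenerate₁₃ F 2) → θ.Admissible F 2 → (cB F θ).C3act * (cB F θ).ε₁ * Real.exp (5 * r₁ F θ + 1) * B12TreeDecay.K₀ 64 8 * 9 * 64 < 1)
    (hκr : ∀ (F : T4Family) (θ : Stage13HParams F 2), θ.Provisos₁₃CoPH F 2 → (θ.ZhUnity F 2 ∧ θ.SlotsNondegenerate₁₃ F 2) → θ.Admissible F 2 → κE F θ ≤ r₁ F θ)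
    (hrenew : ∀ (F : T4Family) (θ : Stage13HParams F 2), θ.Provisos₁₃CoPH F 2 → (θ.ZhUnity F 2 ∧ θ.SlotsNondegenerate₁₃ F 2) → θ.Admissible F 2 → Real.exp 1 * 9 * 64 * B12TreeDecay.K₀ 64 8 ^ 2 * ((cB F θ).C3act * (cB F θ).ε₁) ≤ Mb F θ)
    (hrenewE : ∀ (F : T4Family) (θ : Stage13HParams F 2), θ.Provisos₁₃CoPH F 2 → (θ.ZhUnity F 2 ∧ θ.SlotsNondegenerate₁₃ F 2) → θ.Admissible F 2 → Real.exp 1 * 9 * 64 * B12TreeDecay.K₀ 64 8 ^ 2 * ((cB F θ).C3act * (cB F θ).ε₁) ≤ EA F θ)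
    (hawcw : ∀ (F : T4Family) (θ : Stage13HParams F 2), θ.Provisos₁₃CoPH F 2 → (θ.ZhUnity F 2 ∧ θ.SlotsNondegenerate₁₃ F 2) → θ.Admissible F 2 → ∀ K k j, aw F θ K k j ≤ cw F θ)
    (hC1 : ∀ (F : T4Family) (θ : Stage13HParams F 2), θ.Provisos₁₃CoPH F 2 → (θ.ZhUnity F 2 ∧ θ.SlotsNondegenerate₁₃ F 2) → θ.Admissible F 2 → 4 * Mb F θ * cw F θ / ϱ F θ < 1)
    (hMb0 : ∀ (F : T4Family) (θ : Stage13HParams F 2), θ.Provisos₁₃CoPH F 2 → (θ.ZhUnity F 2 ∧ θ.SlotsNondegenerate₁₃ F 2) → θ.Admissible F 2 → 0 ≤ Mb F θ)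
    (hϱ : ∀ (F : T4Family) (θ : Stage13HParams F 2), θ.Provisos₁₃CoPH F 2 → (θ.ZhUnity F 2 ∧ θ.SlotsNondegenerate₁₃ F 2) → θ.Admissible F 2 → 0 < ϱ F θ)
    (hR : ∀ (F : T4Family) (θ : Stage13HParams F 2), θ.Provisos₁₃CoPH F 2 → (θ.ZhUnity F 2 ∧ θ.SlotsNondegenerate₁₃ F 2) → θ.Admissible F 2 → cw F θ * EA F θ + ϱ F θ < R F θ)
    (hcS : ∀ (F : T4Family) (θ : Stage13HParams F 2), θ.Provisos₁₃CoPH F 2 → (θ.ZhUnity F 2 ∧ θ.SlotsNondegenerate₁₃ F 2) → θ.Admissible F 2 → 0 < cS F θ)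
    (hBq : ∀ (F : T4Family) (θ : Stage13HParams F 2), θ.Provisos₁₃CoPH F 2 → (θ.ZhUnity F 2 ∧ θ.SlotsNondegenerate₁₃ F 2) → θ.Admissible F 2 → 0 ≤ Bq F θ)
    (hballS : ∀ (F : T4Family) (θ : Stage13HParams F 2), θ.Provisos₁₃CoPH F 2 → (θ.ZhUnity F 2 ∧ θ.SlotsNondegenerate₁₃ F 2) → θ.Admissible F 2 → ∀ K, ∀ s ∈ Set.Ioc (0 : ℝ) θ.γ, Metric.closedBall (s : ℂ) (cS F θ * s) ⊆ O F θ K)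
    (hholS : ∀ (F : T4Family) (θ : Stage13HParams F 2), θ.Provisos₁₃CoPH F 2 → (θ.ZhUnity F 2 ∧ θ.SlotsNondegenerate₁₃ F 2) → θ.Admissible F 2 →
      ∀ (K k : ℕ) (old : OlderTerms (F.P K) (𝔸 F θ) (M F θ) k), old ∈ AdmHist (sp F θ K) (EA F θ) (r₁ F θ) k ∧ old 0 = 0 → ∀ (X : (domSys (F.P K) (M F θ) (k + 1)).Dom), ∀ φ ∈ sp F θ K (k + 1) X,
      DifferentiableOn ℂ (fun z => ((𝔇 F θ K).Gn k).E z old φ X) (O F θ K))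
    (hbdS : ∀ (F : T4Family) (θ : Stage13HParams F 2), θ.Provisos₁₃CoPH F 2 → (θ.ZhUnity F 2 ∧ θ.SlotsNondegenerate₁₃ F 2) → θ.Admissible F 2 →
      ∀ (K k : ℕ) (old : OlderTerms (F.P K) (𝔸 F θ) (M F θ) k), old ∈ AdmHist (sp F θ K) (EA F θ) (r₁ F θ) k ∧ old 0 = 0 → ∀ (X : (domSys (F.P K) (M F θ) (k + 1)).Dom), ∀ φ ∈ sp F θ K (k + 1) X,
      ∀ s ∈ Set.Ioc (0 : ℝ) θ.γ, ∀ z ∈ Metric.closedBall (s : ℂ) (cS F θ * s),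
        ‖((𝔇 F θ K).Gn k).E z old φ X - V F θ K k old φ X‖ ≤ Bq F θ * Real.exp (-(κE F θ * (domSys (F.P K) (M F θ) (k + 1)).dj X)) * s ^ 2)
    (hU : ∀ (F : T4Family) (θ : Stage13HParams F 2), θ.Provisos₁₃CoPH F 2 → (θ.ZhUnity F 2 ∧ θ.SlotsNondegenerate₁₃ F 2) → θ.Admissible F 2 → ∀ K k X, IsOpen (U F θ K k X))
    (hrU : ∀ (F : T4Family) (θ : Stage13HParams F 2), θ.Provisos₁₃CoPH F 2 → (θ.ZhUnity F 2 ∧ θ.SlotsNondegenerate₁₃ F 2) → θ.Admissible F 2 → ∀ K k X, Metric.ball (0 : Ec F θ K k) (r F θ) ⊆ U F θ K k X)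
    (hΦhol : ∀ (F : T4Family) (θ : Stage13HParams F 2), θ.Provisos₁₃CoPH F 2 → (θ.ZhUnity F 2 ∧ θ.SlotsNondegenerate₁₃ F 2) → θ.Admissible F 2 → ∀ (K k : ℕ) (X : (domSys (F.P K) (M F θ) (k + 1)).Dom), DifferentiableOn ℂ (Φ F θ K k X) (U F θ K k X))
    (hΦemb : ∀ (F : T4Family) (θ : Stage13HParams F 2), θ.Provisos₁₃CoPH F 2 → (θ.ZhUnity F 2 ∧ θ.SlotsNondegenerate₁₃ F 2) → θ.Admissible F 2 →
      (letI := θ.instVβ₁; letI := θ.instVβ₂;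
      ∀ (K k : ℕ) (X : (domSys (F.P K) (M F θ) (k + 1)).Dom) (Bf : Fin (F.P K).d → Site (F.P K) (k + 1) → θ.Vβ),
        Φ F θ K k X (ι F θ K k X Bf) = emb F θ K k (fun l t => NormedSpace.exp (θ.ρ8 (Bf l t)))))
    (hΦsp : ∀ (F : T4Family) (θ : Stage13HParams F 2), θ.Provisos₁₃CoPH F 2 → (θ.ZhUnity F 2 ∧ θ.SlotsNondegenerate₁₃ F 2) → θ.Admissible F 2 → ∀ (K k : ℕ) (X : (domSys (F.P K) (M F θ) (k + 1)).Dom), ∀ z ∈ U F θ K k X, ∀ Z : (domSys (F.P K) (M F θ) (k + 1)).Dom, Z.1 ⊆ X.1 → Φ F θ K k X z ∈ sp F θ K (k + 1) Z)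
    (hw₀ : ∀ (F : T4Family) (θ : Stage13HParams F 2), θ.Provisos₁₃CoPH F 2 → (θ.ZhUnity F 2 ∧ θ.SlotsNondegenerate₁₃ F 2) → θ.Admissible F 2 → ∀ K k X t, 0 ≤ w F θ K k X t)
    (hw : ∀ (F : T4Family) (θ : Stage13HParams F 2), θ.Provisos₁₃CoPH F 2 → (θ.ZhUnity F 2 ∧ θ.SlotsNondegenerate₁₃ F 2) → θ.Admissible F 2 →
      (letI := θ.instVβ₁; letI := θ.instVβ₂; letI := θ.instιβ;
      ∀ (K k : ℕ) (X : (domSys (F.P K) (M F θ) (k + 1)).Dom) (l : Fin (F.P K).d) (t : Site (F.P K) (k + 1)) (cι : θ.ιβ),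
        ‖ι F θ K k X (Pi.single l (Pi.single t (θ.bV cι)))‖ ≤ w F θ K k X t))
    (htail : ∀ (F : T4Family) (θ : Stage13HParams F 2), θ.Provisos₁₃CoPH F 2 → (θ.ZhUnity F 2 ∧ θ.SlotsNondegenerate₁₃ F 2) → θ.Admissible F 2 →
      ∀ (K k : ℕ) (X : (domSys (F.P K) (M F θ) (k + 1)).Dom) (t : Site (F.P K) (k + 1)),
        let e : Site (F.P K) (k + 1) → TPt 4 (domCount (F.P K) (M F θ) (k + 1) * M F θ) := fun x i => (ZMod.cast (x i) : ZMod (domCount (F.P K) (M F θ) (k + 1) * M F θ));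
        w F θ K k X t ≤ B₃ F θ * Real.exp (-δ₀ F θ * distCT (domCount (F.P K) (M F θ) (k + 1)) (M F θ) (e t) (nearT (M := M F θ) (e t) X)))
    (hκ₅ : ∀ (F : T4Family) (θ : Stage13HParams F 2), θ.Provisos₁₃CoPH F 2 → (θ.ZhUnity F 2 ∧ θ.SlotsNondegenerate₁₃ F 2) → θ.Admissible F 2 → delta1 (δ₀ F θ) (κ F θ) ((M F θ : ℝ) * 4) ≤ κ₅ F θ)
    (hω : ∀ (F : T4Family) (θ : Stage13HParams F 2), θ.Provisos₁₃CoPH F 2 → (θ.ZhUnity F 2 ∧ θ.SlotsNondegenerate₁₃ F 2) → θ.Admissible F 2 → 0 < (ℓ F θ).ω)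
    (hθω : ∀ (F : T4Family) (θ : Stage13HParams F 2), θ.Provisos₁₃CoPH F 2 → (θ.ZhUnity F 2 ∧ θ.SlotsNondegenerate₁₃ F 2) → θ.Admissible F 2 → (ℓ F θ).θ₅ ≤ (ℓ F θ).ω ^ 2)
    (hℓκ : ∀ (F : T4Family) (θ : Stage13HParams F 2), θ.Provisos₁₃CoPH F 2 → (θ.ZhUnity F 2 ∧ θ.SlotsNondegenerate₁₃ F 2) → θ.Admissible F 2 → (ℓ F θ).κ ≤ delta1 (δ₀ F θ) (κ F θ) ((M F θ : ℝ) * 4))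
    (hC₉ : ∀ (F : T4Family) (θ : Stage13HParams F 2), θ.Provisos₁₃CoPH F 2 → (θ.ZhUnity F 2 ∧ θ.SlotsNondegenerate₁₃ F 2) → θ.Admissible F 2 →
      (4 * (2 * C₅ F θ / (1 - (ℓ F θ).θ₅) + 2 * ((16 * Mb F θ * B₃ F θ ^ 2 / r F θ ^ 2) * Real.exp (delta1 (δ₀ F θ) (κ F θ) ((M F θ : ℝ) * 4) * ((M F θ : ℝ) * 4) * 3) * B12TreeDecay.K₀ (4 * 2 ^ 4) (2 * 4) * K₁ 4 (δ₀ F θ / 2))) / θ.γ +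
      ((16 * max ((6 * cS F θ ^ 2 + 32 * cS F θ + 64) / cS F θ ^ 2 * Bq F θ) (64 * Mb F θ * cw F θ ^ 2 / ϱ F θ ^ 2 * (Bq F θ * θ.γ / cS F θ) ^ 2 / (1 - 4 * Mb F θ * cw F θ / ϱ F θ)) * B₃ F θ ^ 2 / r F θ ^ 2) * Real.exp (delta1 (δ₀ F θ) (κ F θ) ((M F θ : ℝ) * 4) * ((M F θ : ℝ) * 4) * 3) * B12TreeDecay.K₀ (4 * 2 ^ 4) (2 * 4) *
        K₁ 4 (δ₀ F θ / 2)) * θ.γ / 2) / (ℓ F θ).ω ≤ (ℓ F θ).C₉)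
    (hβ23 : 2 / 3 < β) (hβ1 : β ≤ 1)
    (hmatch : ∀ F : T4Family, 0 < B F ∧ (ℓ₃ F).ε / B F ≤ (ℓ₃ F).b)
    (hend : N16LettersEnd 2 g ℓ₃)
    (hradii : ∀ F : T4Family, (ℓ₃ F).g = gradConst 4 (c' F) ∧ 0 ≤ c' F ∧ 0 < c' F ∧ (ℓ₃ F).b ≤ c' F ∧
      (2 : ℝ) ^ 91 * (F.L : ℝ) ^ 17 * c' F ≤ 1 ∧ (2 : ℝ) ^ 76 * (F.L : ℝ) ^ 12 * c' F ≤ (ℓ₃ F).ε ∧ (ℓ₃ F).ε / B F ≤ 1 / 4 ∧ 4 * ((ℓ₃ F).ε / B F) ≤ c' F)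
    (hclass : ∀ F : T4Family, 16 * B7Prop2Explicit.C0 4 * (ℓ₃ F).ε ≤ 3 ∧ 1024 * (4 + 1) * (4 + 4) * (F.L : ℝ) ^ 2 * (ℓ₃ F).ε ≤ 1)
    (hH3 : ∀ (F : T4Family) (θ : Stage13HParams F 2) (hP : θ.Provisos₁₃CoPH F 2) (g₀ : ℕ → ℝ) (os : List (ULoop F)) (k : ℕ),
      LeafH3sup 4 (rateCarriersOfRecord₁₃CoPH 𝔯 F θ hP g₀ os k).ne3.L (rateCarriersOfRecord₁₃CoPH 𝔯 F θ hP g₀ os k).ne3.Nper (rateCarriersOfRecord₁₃CoPH 𝔯 F θ hP g₀ os k).ne3.ε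
        (rateCarriersOfRecord₁₃CoPH 𝔯 F θ hP g₀ os k).ne3.b (c' F) (rateCarriersOfRecord₁₃CoPH 𝔯 F θ hP g₀ os k).ne3.dom)
    (hsel3 : ∀ (F : T4Family) (θ : Stage13HParams F 2) (hP : θ.Provisos₁₃CoPH F 2) (g₀ : ℕ → ℝ) (os : List (ULoop F)) (k : ℕ),
      ∃ sel : ℕ → (B7Prop1Explicit.Site 4 → Fin 4 → (Matrix (Fin 2) (Fin 2) ℂ)ˣ) → (B7Prop1Explicit.Site 4 → Fin 4 → (Matrix (Fin 2) (Fin 2) ℂ)ˣ),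
        (∀ V ∈ (rateCarriersOfRecord₁₃CoPH 𝔯 F θ hP g₀ os k).ne3.dom, ∀ j : ℕ,
          IsMinimiser 4 (sfClass 4 (rateCarriersOfRecord₁₃CoPH 𝔯 F θ hP g₀ os k).ne3.L (rateCarriersOfRecord₁₃CoPH 𝔯 F θ hP g₀ os k).ne3.Nper (rateCarriersOfRecord₁₃CoPH 𝔯 F θ hP g₀ os k).ne3.ε)
            (rateCarriersOfRecord₁₃CoPH 𝔯 F θ hP g₀ os k).ne3.L (rateCarriersOfRecord₁₃CoPH 𝔯 F θ hP g₀ os k).ne3.Nper j V (sel j V)) ∧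
        (∀ V ∈ (rateCarriersOfRecord₁₃CoPH 𝔯 F θ hP g₀ os k).ne3.dom, ∀ j : ℕ,
          RegularSup 4 (rateCarriersOfRecord₁₃CoPH 𝔯 F θ hP g₀ os k).ne3.L (rateCarriersOfRecord₁₃CoPH 𝔯 F θ hP g₀ os k).ne3.Nper (rateCarriersOfRecord₁₃CoPH 𝔯 F θ hP g₀ os k).ne3.b (c' F) j (sel j V)))
    (hβw : ∀ (F : T4Family) (θ : Stage13HParams F 2) (hP : θ.Provisos₁₃CoPH F 2), (θ.ZhUnity F 2 ∧ θ.SlotsNondegenerate₁₃ F 2) → θ.Admissible F 2 →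
      ∃ γ₀ b b' : ℝ, 0 < γ₀ ∧ 0 < b ∧ DagBinding.BetaBoundsInInterval (datumOfRecord₁₃CoPH F 2 θ hP).C.toB12 γ₀ b b')
    (hζm : ∀ (F : T4Family) (θ : Stage13HParams F 2), θ.Provisos₁₃CoPH F 2 → ((θ.ZhUnity F 2 ∧ θ.SlotsNondegenerate₁₃ F 2) ∧ θ.ppSel = ppSelLiveOfRecord F 2 θ.ν θ.τ9 (EOfRecord₁₃ F 2 θ.toStage13Params) (wOfRecord₉ F 2 θ.toStage9Params)) → θ.Admissible F 2 →
      ZetaMeasurable F 2 θ.ζ)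
    (h20 : ∀ (F : T4Family) (θ : Stage13HParams F 2) (hP : θ.Provisos₁₃CoPH F 2), ((θ.ZhUnity F 2 ∧ θ.SlotsNondegenerate₁₃ F 2) ∧ θ.ppSel = ppSelLiveOfRecord F 2 θ.ν θ.τ9 (EOfRecord₁₃ F 2 θ.toStage13Params) (wOfRecord₉ F 2 θ.toStage9Params)) → θ.Admissible F 2 →
      ∀ (g₀ : ℕ → ℝ) (os : List (ULoop F)),
        ∃ W : ℕ → ℝ, RelWeightBound 1 (classSet₁₃ θ K₀ g₀) (weightA₁₃ θ hP K₀ g₀ os) (weightB₁₃ θ hP K₀ g₀ os) (badClass₁₃ θ K₀ g₀ (jc F θ hP g₀ os)) W)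
    (h21 : ∀ (F : T4Family) (θ : Stage13HParams F 2) (hP : θ.Provisos₁₃CoPH F 2), ((θ.ZhUnity F 2 ∧ θ.SlotsNondegenerate₁₃ F 2) ∧ θ.ppSel = ppSelLiveOfRecord F 2 θ.ν θ.τ9 (EOfRecord₁₃ F 2 θ.toStage13Params) (wOfRecord₉ F 2 θ.toStage9Params)) → θ.Admissible F 2 →
      ∀ (g₀ : ℕ → ℝ) (os : List (ULoop F)),
        ∃ Wsh : ℕ → ℝ, ShellWeightBound 1 (classSet₁₃ θ K₀ g₀) (weightA₁₃ θ hP K₀ g₀ os) (weightB₁₃ θ hP K₀ g₀ os) (sh F θ hP g₀ os).1 (sh F θ hP g₀ os).2 Wsh)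
    (hlinkBareV : ∀ (F : T4Family) (θ : Stage13HParams F 2) (hP : θ.Provisos₁₃CoPH F 2), ((θ.ZhUnity F 2 ∧ θ.SlotsNondegenerate₁₃ F 2) ∧ θ.ppSel = ppSelLiveOfRecord F 2 θ.ν θ.τ9 (EOfRecord₁₃ F 2 θ.toStage13Params) (wOfRecord₉ F 2 θ.toStage9Params)) → θ.Admissible F 2 →
      ∀ (γ gIR b : ℝ) (g₀ : ℕ → ℝ), (datumOfRecord₁₃CoPH F 2 θ hP).Tuned γ gIR g₀ → γ ≤ θ.γ → γ ^ 2 ≤ Real.exp (-1) → 0 < b →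
      (∀ K m, 0 ≤ m → m < K → b ≤ (datumOfRecord₁₃CoPH F 2 θ hP).βfun m (prefixOf (runFlow (datumOfRecord₁₃CoPH F 2 θ hP) g₀ K) m)) →
      ∀ (os : List (ULoop F)) (k : ℕ),
      let S : SpineCarriers := crOfRecord₁₃VAt K₀ (jc F θ hP g₀ os) sh F θ hP g₀ os
      let R : RateCarriers 2 := rateCarriersOfRecord₁₃CoPH 𝔯 F θ hP g₀ os k
      let D : Datum F 2 := datumOfRecord₁₃CoPH F 2 θ hP
      letI := S.dec
      ∃ (_ : DecidableEq R.u3.C.Dom) (F' : Type) (ι' X' : Type) (_ : MeasurableSpace ι')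
        (L : LedgerDataSync R.u3.C F' ι' S.ι) (Rd : Readings ι' X') (bsel : (ℕ → ℝ) → ℝ) (EB : Functional R.u3.C R.u3.C.BgB)
        (g : ℕ → ℕ → ℝ)
        (uA : ℕ → ι' → R.u3.C.BgA) (uB : ℕ → ι' → R.u3.C.BgB)
        (Koff : ℕ) (cells : (K j : ℕ) → R.u3.C.Dom → Finset (Site (F.P (Koff + K)) j))
        (θ : ℝ)
        (rd : ι' → (B7Prop1Explicit.Site 4 → Fin 4 → (Matrix (Fin 2) (Fin 2) ℂ)ˣ)),
        (∀ K i, i ≤ K → g K i = runFlow D g₀ K i) ∧ (∀ K i, K < i → g K i = gIR) ∧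
        EB = (fun s => R.u3.EB (bsel s) s) ∧
        (∀ (Sz : ℕ → ℝ → S.ι → ℕ → ℝ) (E₀ : ℝ) (m : ℕ) (a : ℝ) (Cw Λg : ℝ),
          (∀ K t, |t| ≤ S.l₀ → ∀ τ ∈ S.T K \ S.Bad K t, ∀ v ∈ Rd.dom, ∀ j ≤ K,
            |∑ X ∈ L.fac K t τ with R.u3.C.scale X = j,
                (Real.log (Real.exp (EB (fun i => g (K + 1) (i + 1)) (uB K v) X
                    - EB (fun i => g (K + 1) (i + 1)) L.oneB X))
                  - Real.log (Real.exp (R.u3.EA (g K) (uA K v) X - R.u3.EA (g K) L.oneA X)))| ≤ Sz K t τ j) →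
          0 ≤ E₀ → 0 < a → a < 1 →
          (∀ K t, |t| ≤ S.l₀ → ∀ τ ∈ S.T K \ S.Bad K t, ∀ j ≤ K,
            Sz K t τ j ≤ S.vol * (E₀ * ((K : ℝ) + 1) ^ m * a ^ (K - j))) →
          (∀ K, Multiplicity (L.All K) R.u3.C.scale (fun X => Real.exp (-(R.u3.κ * R.u3.C.d X))) Cw S.vol Λg K) →
          (∀ K t, |t| ≤ S.l₀ → ∀ τ ∈ S.T K \ S.Bad K t,
            WindowMultiplicity (L.facO K t τ) L.scO L.wO Cw S.vol Λg (jlogOf L.Cl K) K) →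
          1 ≤ Λg → L.θ' ≤ Λg →
          LedgerAtSync { L with S := Sz, E₀ := E₀, m := m, a := a, Cw := Cw, Λg := Λg } S.l₀ S.vol S.T S.Bad
            (fun K t τ => S.A K t τ - S.shA K t τ) (fun K t τ => S.B K t τ - S.shB K t τ) Rd R.u3.EA EB R.u3.κ g uA uB
            R.u3.ω R.u3.ρ R.u3.θ (θ ^ ((3 : ℝ) * β - 2))) ∧
        (∀ K t, |t| ≤ S.l₀ → ∀ τ ∈ S.T K \ S.Bad K t,
          WindowMultiplicity (L.facO K t τ) L.scO L.wO L.Cw S.vol L.Λg (jlogOf L.Cl K) K) ∧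
        0 ≤ L.Cw ∧ 1 ≤ L.Λg ∧ L.θ' ≤ L.Λg ∧
        (∀ K, ∀ X ∈ L.All K,
          (cells K (R.u3.C.scale X + Koff) X).Nonempty ∧ TFaceConnected (cells K (R.u3.C.scale X + Koff) X)) ∧
        (∀ K j, Set.InjOn (cells K j) ↑((L.All K).filter fun X => R.u3.C.scale X + Koff = j)) ∧
        (∀ K, ∀ X ∈ L.All K, torusTreeLen (cells K (R.u3.C.scale X + Koff) X) ≤ R.u3.C.d X) ∧
        0 < θ ∧ θ ^ 6 = ((R.ne3.L : ℝ))⁻¹ ∧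
        (∀ v ∈ Rd.dom, rd v ∈ R.ne3.dom) ∧
        (∀ k, ∀ v ∈ Rd.dom, Rd.act k v = minAct 4 (sfClass 4 R.ne3.L R.ne3.Nper R.ne3.ε) R.ne3.L R.ne3.Nper k (rd v)) ∧
        (R.ne3.Nper : ℝ) ^ 4 ≤ Rd.vol ∧
        (∀ s ∈ Window γ, 0 < bsel s ∧ bsel s ≤ γ))
    (htarget : ∀ (F : T4Family) (θ : Stage13HParams F 2) (hP : θ.Provisos₁₃CoPH F 2), ((θ.ZhUnity F 2 ∧ θ.SlotsNondegenerate₁₃ F 2) ∧ ¬ θ.ppSel = ppSelLiveOfRecord F 2 θ.ν θ.τ9 (EOfRecord₁₃ F 2 θ.toStage13Params) (wOfRecord₉ F 2 θ.toStage9Params)) → θ.Admissible F 2 →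
        ForSmallCouplings (datumOfRecord₁₃CoPH F 2 θ hP) fun g₀ => ∀ os : List (ULoop F),
          (RatesHolderAt (datumOfRecord₁₃CoPH F 2 θ hP) (rateCarriersOfRecord₁₃CoPH 𝔯 F θ hP g₀ os (ksel F θ hP g₀ os)) β ∧
              ReadOutAt (datumOfRecord₁₃CoPH F 2 θ hP) (rateCarriersOfRecord₁₃CoPH 𝔯 F θ hP g₀ os (ksel F θ hP g₀ os)).u3 ∧
              (0 ≤ (rateCarriersOfRecord₁₃CoPH 𝔯 F θ hP g₀ os (ksel F θ hP g₀ os)).u3.ρ ∧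
                (rateCarriersOfRecord₁₃CoPH 𝔯 F θ hP g₀ os (ksel F θ hP g₀ os)).u3.ρ < 1)) →
            ∃ δ : ℕ → ℝ, Target ((F.side : ℝ) ^ 4) 1 δ (fun K => T4GenFunBounds.schemeZ ((datumOfRecord₁₃CoPH F 2 θ hP).scheme g₀) os (K₀ + K))) :
    SpineGivenEndpointR13SepCoPHV := by
  have hρ : ∀ (F : T4Family) (θ : Stage13HParams F 2), θ.Provisos₁₃CoPH F 2 → (θ.ZhUnity F 2 ∧ θ.SlotsNondegenerate₁₃ F 2) → θ.Admissible F 2 →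
      0 ≤ (ℓ F θ).ρ ∧ (ℓ F θ).ρ < 1 := fun F θ hP hG hθ => ⟨(hs F θ hP hG hθ).ρ_nonneg, (hs F θ hP hG hθ).ρ_lt_one⟩
  have h22' : ∀ (F : T4Family) (θ : Stage13HParams F 2), θ.Provisos₁₃CoPH F 2 → (θ.ZhUnity F 2 ∧ θ.SlotsNondegenerate₁₃ F 2) → θ.Admissible F 2 →
      ∀ k : ℕ, N22At (u3OfRecord₁₃ θ.toStage13Params (objectsOfRecord₁₃ F 2 θ.toStage13Params (ℓ F θ)) k) := fun F θ hP hG hθ k =>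
    n22At_u3OfRecord₁₃_of_kernelStepRate_termDataTableGermsLocatedRadiiNonexpansive F 2 θ.toStage13Params (ℓ F θ) (hs F θ hP hG hθ) hθ.toStage12.toStage9.gamma_pos (hlim F θ hP hG hθ)
      (hC₅ F θ hP hG hθ) (h5 F θ hP hG hθ) (m' F θ) (M F θ) (hM F θ hP hG hθ) (𝔇 F θ) (emb F θ) (hloc F θ hP hG hθ) (sp F θ) (hsp F θ hP hG hθ) (hκh F θ hP hG hθ) (hδ₀ F θ hP hG hθ)
      (hB₃ F θ hP hG hθ) (hr F θ hP hG hθ) (hκE F θ hP hG hθ) (hκE0 F θ hP hG hθ) (hE₀ F θ hP hG hθ) (big F θ) (hbigo F θ hP hG hθ) (hrestr F θ hP hG hθ) (hbig F θ hP hG hθ) (cB F θ)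
      (hL8 F θ hP hG hθ) (hLc F θ hP hG hθ) (hκ₁ F θ hP hG hθ) (hα₆ F θ hP hG hθ) (hN F θ hP hG hθ) (hloc18 F θ hP hG hθ) (hD F θ hP hG hθ) (χu F θ) (χcu F θ) (𝒲 F θ) (𝒪 F θ) (Rt F θ)
      (Wn F θ) (hlaw F θ hP hG hθ) (hread F θ hP hG hθ) (hmaps F θ hP hG hθ) (hW F θ hP hG hθ) (hcont F θ hP hG hθ) (hjc F θ hP hG hθ) (hKb F θ hP hG hθ) (hμ F θ hP hG hθ) (hCk F θ hP hG hθ)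
      (hmk F θ hP hG hθ) (hWm F θ hP hG hθ) (hbw F θ hP hG hθ) (hbaw F θ hP hG hθ) (hι F θ hP hG hθ) (hA0 F θ hP hG hθ) (hr₁ F θ hP hG hθ) (hrate F θ hP hG hθ) (hKP F θ hP hG hθ)
      (hκr F θ hP hG hθ) (hrenew F θ hP hG hθ) (hrenewE F θ hP hG hθ) (hawcw F θ hP hG hθ) (hC1 F θ hP hG hθ) (hMb0 F θ hP hG hθ) (hϱ F θ hP hG hθ) (hR F θ hP hG hθ) (O F θ) (V F θ)
      (hcS F θ hP hG hθ) (hBq F θ hP hG hθ) (hballS F θ hP hG hθ) (hholS F θ hP hG hθ) (hbdS F θ hP hG hθ) (Ec F θ) (ι F θ) (Φ F θ) (U F θ) (hU F θ hP hG hθ) (hrU F θ hP hG hθ)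
      (hΦhol F θ hP hG hθ) (hΦemb F θ hP hG hθ) (hΦsp F θ hP hG hθ) (w F θ) (hw₀ F θ hP hG hθ) (hw F θ hP hG hθ) (htail F θ hP hG hθ) (hκ₅ F θ hP hG hθ) (hω F θ hP hG hθ) (hθω F θ hP hG hθ)
      (hℓκ F θ hP hG hθ) (hC₉ F θ hP hG hθ) k
  have h18' : ∀ (F : T4Family) (θ : Stage13HParams F 2), θ.Provisos₁₃CoPH F 2 → (θ.ZhUnity F 2 ∧ θ.SlotsNondegenerate₁₃ F 2) → θ.Admissible F 2 →
      ∀ k : ℕ, N18At (u3OfRecord₁₃ θ.toStage13Params (objectsOfRecord₁₃ F 2 θ.toStage13Params (ℓ F θ)) k) := fun F θ hP hG hθ k =>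
    n18At_u3OfRecord₁₃_objectsOfRecord₁₃_of_kernelStepRateOfRecord₁₃ F 2 θ.toStage13Params (ℓ F θ) k
      (kernelStepRateOfRecord₁₃_mono F 2 θ.toStage13Params (h5 F θ hP hG hθ) ((hℓκ F θ hP hG hθ).trans (hκ₅ F θ hP hG hθ)) (hs F θ hP hG hθ).θ₅_pos.le le_rfl
        (hC₅ℓ F θ hP hG hθ) (hs F θ hP hG hθ).C₅_nonneg)
  exact fun F θ h v hG hθ _ _ =>
    hybridNE7Under_of_forSmallCouplings_stringwise (Node00.datumOfRecord₁₃SepCoPHV F 2 θ h v)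
      (show ForSmallCouplings (Node00.datumOfRecord₁₃SepCoPHV F 2 θ h v) (fun g₀ => StringwiseHybridNE7 ((Node00.datumOfRecord₁₃SepCoPHV F 2 θ h v).scheme g₀)) from
        bodyBFree₁₃CoPH_of_split (fun F (θ : Stage13HParams F 2) => (θ.ZhUnity F 2 ∧ θ.SlotsNondegenerate₁₃ F 2)) (fun F (θ : Stage13HParams F 2) => θ.ppSel = ppSelLiveOfRecord F 2 θ.ν θ.τ9 (EOfRecord₁₃ F 2 θ.toStage13Params) (wOfRecord₉ F 2 θ.toStage9Params))
          (bodyBFree₁₃CoPH_of_v5pins_bareLedgerReadingV_kernelFaces_at_crOfRecord₁₃VAt_cut K₀ jc sh β 𝔯 ℓ ℓ₃ g B c'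
          (fun F (θ : Stage13HParams F 2) => (θ.ZhUnity F 2 ∧ θ.SlotsNondegenerate₁₃ F 2) ∧ θ.ppSel = ppSelLiveOfRecord F 2 θ.ν θ.τ9 (EOfRecord₁₃ F 2 θ.toStage13Params) (wOfRecord₉ F 2 θ.toStage9Params))
          ksel hpin1 hpin2 hpinL hpin (fun F hF => h16 F (hF.elim fun θ h => ⟨θ, h.1, h.2.1.1, h.2.2⟩)) (fun F θ hP hRg hθ => hs F θ hP hRg.1 hθ) (fun F θ hP hRg hθ => hκ F θ hP hRg.1 hθ)
          (fun F θ hP hRg hθ => hcr F θ hP hRg.1 hθ) (fun F θ hP hRg hθ => hκ₀ F θ hP hRg.1 hθ) (fun μ ν F θ hP hRg hθ => hK μ ν F θ hP hRg.1 hθ) (fun F θ hP hRg hθ => h18' F θ hP hRg.1 hθ)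
          (fun F θ hP hRg hθ => h22' F θ hP hRg.1 hθ) hβ23 hβ1 hmatch hend hradii hclass hH3 hsel3
          (fun F θ hP hRg hθ => hβw F θ hP hRg.1 hθ) (fun _ _ _ hRg _ => ⟨_, hRg.2⟩) hζm h20 h21 hlinkBareV)
          (bodyBFree₁₃CoPH_of_kernels_pin_bFree (crOneTerm₁₃ K₀) 𝔯 ksel (fun {F} (θ : Stage13HParams F 2) => ((θ.ZhUnity F 2 ∧ θ.SlotsNondegenerate₁₃ F 2) ∧ ¬ θ.ppSel = ppSelLiveOfRecord F 2 θ.ν θ.τ9 (EOfRecord₁₃ F 2 θ.toStage13Params) (wOfRecord₉ F 2 θ.toStage9Params))) ℓ β hpin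
            (fun F θ hP hRg hθ => ForSmallCouplings.of_forall fun g₀ os => by
              refine ⟨?_, ?_, ?_⟩
              · exact n14At_rateCarriersOfRecord₁₃CoPH_of_pinned 𝔯 hpin1 F θ hP g₀ os (ksel F θ hP g₀ os)
              · obtain ⟨b, aS, ν, μ, α, β', c35, p, hb, haS, h⟩ := hpin2
                rw [h F θ hP g₀ os]
                exact n15At_fullGSizedObjects_family hb haS ν μ α β' c35 p F
              · show N16HolderAt (rateCarriersOfRecord₁₃CoPH 𝔯 F θ hP g₀ os (ksel F θ hP g₀ os)).ne3 β
                rw [rateCarriers_ne3_of_pinnedLoose hpinL F θ hP g₀ os (ksel F θ hP g₀ os)]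
                exact h16 F ⟨θ, hP, hRg.1, hθ⟩)
            (fun F θ hP hRg hθ => hs F θ hP hRg.1 hθ) (fun F θ hP hRg hθ => hκ F θ hP hRg.1 hθ) (fun F θ hP hRg hθ => hcr F θ hP hRg.1 hθ)
            (fun F θ hP hRg hθ => hρ F θ hP hRg.1 hθ) (h20_shape_crOneTerm₁₃ K₀) (h21_shape_crOneTerm₁₃ K₀)
            (fun F θ hP hRg hθ => (htarget F θ hP hRg hθ).mono fun g₀ hg os hPr =>
              (core_crOneTerm₁₃_iff_target K₀ θ hP g₀ os).2 (hg os hPr))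
            (fun _ θ hP _ _ => ForSmallCouplings.of_forall fun g₀ os => extraction_crOneTerm₁₃ K₀ θ hP g₀ os)
            (fun F θ hP hRg hθ => hK 0 1 F θ hP hRg.1 hθ) (fun F θ hP hRg hθ => h18' F θ hP hRg.1 hθ)
            (fun F θ hP hRg hθ => h22' F θ hP hRg.1 hθ))
          F θ h.toCore hG hθ) _

end Summit.QuantumFields.YangMills.Theorems.BalabanUVNodesN27SpineRecord
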